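import Mathlib
import Literature.NumberTheory.Transcendental.ZagierDilogarithmConjecture
import Literature.NumberTheory.Transcendental.BlochWignerDilogarithm
import Summits.KontsevichZagierPeriods.KontsevichZagierPeriods.Theorems.HyperbolicBlochZagierDilogarithmConjectureStubKummerDescent
import Summits.KontsevichZagierPeriods.KontsevichZagierPeriods.Theorems.HyperbolicBlochZagierDilogarithmConjectureClausenTransfer
import HarnessLib

/-!
# The Galois-twisted regulator kills the relator group; Galois propagation from the crux and
# for imaginary quadratic points

Helpers for the stub `stub_galoisPropagation` (OPEN CORE (b)) of the line
`kummer-clausen-linearisation` for the crux `ZagierDilogarithmConjecture`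
(stmt-KontsevichZagierPeriods-10550, route `HyperbolicBloch`).

Write `K = ℚ̄ = algebraicClosure ℚ ℂ ⊆ ℂ`, `D = blochWignerDilog`, and for a `ℚ`-algebra embedding
`σ : K →ₐ[ℚ] ℂ` call an additive map `g : ℤ[ℂ] → ℝ` a *Galois-twisted regulator at `σ`* if
`g[z] = D(σ z) − D(σ z̄)` for every algebraic `z` (such a `g` exists, `exists_galoisRegulator`:
extend by `0` on transcendental generators; no new definition is introduced, the theorems below
quantify over all such `g`).

* `galoisRegulator_eq_zero_of_mem_closure` (SOUNDNESS): every Galois-twisted regulator `g` at `σ`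
  that vanishes on real transcendental generators vanishes on `⟨dilogRelators⟩`: `σ` and
  `σ ∘ conj` are injective ring homomorphisms, so they carry a five-term configuration at `(x, y)`
  to the five-term configurations at `(σx, σy)`, `(σx̄, σȳ)`, both killed by Neumann's five-term
  identity for `D` (`five_term_neumann`); `[w] + [w̄]` telescopes; a real algebraic `[w]` gives
  `D(σw) − D(σw) = 0`.
* `galoisPropagation_of_relationsConjecture`, `stub_galoisPropagationOfCrux` (crux ⇒ stub):
  Zagier's conjecture puts `Σ mᵢ[uᵢ]` in `⟨dilogRelators⟩`, and
  `g(Σ mᵢ[uᵢ]) = Σ mᵢ (D(σuᵢ) − D(σūᵢ))`.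
* `stub_galoisPropagationImaginaryQuadratic` (an unconditional case of the stub): if all `uᵢ` lie
  in one imaginary quadratic field `ℚ(√−d)`, every `σ` sends `√−d` to `±√−d` with one sign for all
  `i`, so `{σuᵢ, σūᵢ} = {uᵢ, ūᵢ}` uniformly in `i` and the twisted sum is `±2 Σ mᵢ D(uᵢ) = 0`
  (`D(z̄) = −D(z)`).
-/

noncomputable section

open scoped BigOperators ComplexConjugate
open Literature.NumberTheory.Transcendental

namespace Summit.KontsevichZagierPeriods.HyperbolicBloch.ZagierDilogarithm

/-! ## §1 Galois-twisted regulators `g : [z] ↦ D(σz) − D(σz̄)` -/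

/-- `ℚ̄ ⊆ ℂ` is stable under complex conjugation. [folklore] -/
theorem conj_mem_algebraicClosure {z : ℂ} (hz : z ∈ algebraicClosure ℚ ℂ) :
    conj z ∈ algebraicClosure ℚ ℂ :=
  mem_algebraicClosure_iff.2 (isAlgebraic_conj (mem_algebraicClosure_iff.1 hz))

variable (σ : ↥(algebraicClosure ℚ ℂ) →ₐ[ℚ] ℂ)

/-- **Existence of the Galois-twisted, conjugation-odd regulator** at a `ℚ`-algebra embedding
`σ : ℚ̄ → ℂ` (`ℚ̄ = algebraicClosure ℚ ℂ`): an additive map `g : ℤ[ℂ] → ℝ` with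
`g[z] = D(σ w) − D(σ w')` for algebraic `z` and any lifts `w, w' ∈ ℚ̄` of `z, z̄`, and `g[z] = 0`
for transcendental `z` (`D` the Bloch–Wigner dilogarithm) — the additive extension
(`FreeAbelianGroup.lift`) of this generator assignment. For `σ` the inclusion,
`g[z] = D(z) − D(z̄) = 2D(z)` (`z ∉ ℝ`). [folklore] -/
theorem exists_galoisRegulator :
    ∃ g : FreeAbelianGroup ℂ →+ ℝ,
      (∀ (z : ℂ) (w w' : ↥(algebraicClosure ℚ ℂ)), (w : ℂ) = z → (w' : ℂ) = conj z →
          g (FreeAbelianGroup.of z) = blochWignerDilog (σ w) - blochWignerDilog (σ w')) ∧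
        ∀ z : ℂ, ¬IsAlgebraic ℚ z → g (FreeAbelianGroup.of z) = 0 := by
  classical
  refine ⟨FreeAbelianGroup.lift fun z => if h : IsAlgebraic ℚ z then
      blochWignerDilog (σ ⟨z, mem_algebraicClosure_iff.2 h⟩) -
        blochWignerDilog (σ ⟨conj z, mem_algebraicClosure_iff.2 (isAlgebraic_conj h)⟩) else 0,
    ?_, fun z hz => by rw [FreeAbelianGroup.lift_apply_of, dif_neg hz]⟩
  rintro _ w w' rfl hw'
  have hz : IsAlgebraic ℚ (w : ℂ) := mem_algebraicClosure_iff.1 w.2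
  have e' : w' = ⟨conj (w : ℂ), conj_mem_algebraicClosure w.2⟩ := Subtype.ext hw'
  subst e'
  rw [FreeAbelianGroup.lift_apply_of, dif_pos hz]

variable {σ}

/-- The value of a Galois-twisted regulator `g` at `σ` on `Σ mᵢ[uᵢ]` in terms of lifts
`wᵢ, w'ᵢ ∈ ℚ̄` of `uᵢ, ūᵢ`: `Σ mᵢ (D(σ wᵢ) − D(σ w'ᵢ))`. [folklore] -/
theorem galoisRegulator_sum_zsmul_of (g : FreeAbelianGroup ℂ →+ ℝ)
    (hg : ∀ (z : ℂ) (w w' : ↥(algebraicClosure ℚ ℂ)), (w : ℂ) = z → (w' : ℂ) = conj z →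
      g (FreeAbelianGroup.of z) = blochWignerDilog (σ w) - blochWignerDilog (σ w'))
    {k : ℕ} (u : Fin k → ℂ) (m : Fin k → ℤ) (w w' : Fin k → ↥(algebraicClosure ℚ ℂ))
    (hw : ∀ i, (w i : ℂ) = u i) (hw' : ∀ i, (w' i : ℂ) = conj (u i)) :
    g (∑ i, m i • FreeAbelianGroup.of (u i)) =
      ∑ i, (m i : ℝ) * (blochWignerDilog (σ (w i)) - blochWignerDilog (σ (w' i))) := by
  simp only [map_sum, map_zsmul]
  exact Finset.sum_congr rfl fun i _ => by rw [hg (u i) (w i) (w' i) (hw i) (hw' i), zsmul_eq_mul]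

/-! ## §2 Soundness: Galois-twisted regulators kill the relator group -/

variable (σ) in
/-- **The five-term identity transported along an embedding.** For `X, Y ∈ ℚ̄ ∖ {0, 1}`, `X ≠ Y`,
and a `ℚ`-embedding `σ : ℚ̄ → ℂ` (an injective ring homomorphism),
`D(σX) − D(σY) + D(σ(Y/X)) − D(σ((1 − X⁻¹)/(1 − Y⁻¹))) + D(σ((1 − X)/(1 − Y))) = 0`: the image of a
five-term configuration is the five-term configuration at `(σX, σY)`.
[cite: Neumann1998, §2 eq. (2.3)] -/
theorem five_term_algHom {X Y : ↥(algebraicClosure ℚ ℂ)} (hX0 : X ≠ 0) (hX1 : X ≠ 1)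
    (hY0 : Y ≠ 0) (hY1 : Y ≠ 1) (hXY : X ≠ Y) :
    blochWignerDilog (σ X) - blochWignerDilog (σ Y) + blochWignerDilog (σ (Y / X)) -
        blochWignerDilog (σ ((1 - X⁻¹) / (1 - Y⁻¹))) +
        blochWignerDilog (σ ((1 - X) / (1 - Y))) = 0 := by
  have hinj : Function.Injective σ := (σ : ↥(algebraicClosure ℚ ℂ) →+* ℂ).injective
  rw [map_div₀, map_div₀, map_div₀, map_sub, map_sub, map_sub, map_sub, map_one, map_inv₀,
    map_inv₀]
  refine five_term_neumann ?_ ?_ ?_ ?_ ?_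
  · exact fun h => hX0 (hinj (by rw [h, map_zero]))
  · exact fun h => hX1 (hinj (by rw [h, map_one]))
  · exact fun h => hY0 (hinj (by rw [h, map_zero]))
  · exact fun h => hY1 (hinj (by rw [h, map_one]))
  · exact fun h => hXY (hinj h)

/-- A Galois-twisted regulator `g` at `σ` kills every five-term relator with algebraic entries:
the two halves `Σ ± D(σ ·)` and `Σ ± D(σ conj ·)` of its value are transported five-term
identities, at `(σx, σy)` and at `(σx̄, σȳ)`. [cite: Neumann1998, §2 eq. (2.3)] -/
theorem galoisRegulator_fiveTerm (g : FreeAbelianGroup ℂ →+ ℝ)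
    (hg : ∀ (z : ℂ) (w w' : ↥(algebraicClosure ℚ ℂ)), (w : ℂ) = z → (w' : ℂ) = conj z →
      g (FreeAbelianGroup.of z) = blochWignerDilog (σ w) - blochWignerDilog (σ w'))
    {x y : ℂ} (hx : IsAlgebraic ℚ x) (hy : IsAlgebraic ℚ y) (hx0 : x ≠ 0) (hx1 : x ≠ 1)
    (hy0 : y ≠ 0) (hy1 : y ≠ 1) (hxy : x ≠ y) :
    g (FreeAbelianGroup.of x - FreeAbelianGroup.of y + FreeAbelianGroup.of (y / x) -
        FreeAbelianGroup.of ((1 - x⁻¹) / (1 - y⁻¹)) + FreeAbelianGroup.of ((1 - x) / (1 - y))) =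
      0 := by
  -- the lifts of `x, y, x̄, ȳ` to `ℚ̄`
  set X : ↥(algebraicClosure ℚ ℂ) := ⟨x, mem_algebraicClosure_iff.2 hx⟩
  set Y : ↥(algebraicClosure ℚ ℂ) := ⟨y, mem_algebraicClosure_iff.2 hy⟩
  set X' : ↥(algebraicClosure ℚ ℂ) := ⟨conj x, mem_algebraicClosure_iff.2 (isAlgebraic_conj hx)⟩
  set Y' : ↥(algebraicClosure ℚ ℂ) := ⟨conj y, mem_algebraicClosure_iff.2 (isAlgebraic_conj hy)⟩
  have hX0 : X ≠ 0 := fun e => hx0 (congrArg Subtype.val e)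
  have hX1 : X ≠ 1 := fun e => hx1 (congrArg Subtype.val e)
  have hY0 : Y ≠ 0 := fun e => hy0 (congrArg Subtype.val e)
  have hY1 : Y ≠ 1 := fun e => hy1 (congrArg Subtype.val e)
  have hXY : X ≠ Y := fun e => hxy (congrArg Subtype.val e)
  have hx0' : conj x ≠ 0 := by simpa using (map_ne_zero (starRingEnd ℂ)).2 hx0
  have hy0' : conj y ≠ 0 := by simpa using (map_ne_zero (starRingEnd ℂ)).2 hy0
  have hx1' : conj x ≠ 1 := fun h => hx1 (by simpa using congrArg conj h)
  have hy1' : conj y ≠ 1 := fun h => hy1 (by simpa using congrArg conj h)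
  have hxy' : conj x ≠ conj y := fun h => hxy (by simpa using congrArg conj h)
  have hX0' : X' ≠ 0 := fun e => hx0' (congrArg Subtype.val e)
  have hX1' : X' ≠ 1 := fun e => hx1' (congrArg Subtype.val e)
  have hY0' : Y' ≠ 0 := fun e => hy0' (congrArg Subtype.val e)
  have hY1' : Y' ≠ 1 := fun e => hy1' (congrArg Subtype.val e)
  have hXY' : X' ≠ Y' := fun e => hxy' (congrArg Subtype.val e)
  -- the values of `g` on the five generators
  have e1 : g (FreeAbelianGroup.of x) = blochWignerDilog (σ X) - blochWignerDilog (σ X') :=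
    hg x X X' rfl rfl
  have e2 : g (FreeAbelianGroup.of y) = blochWignerDilog (σ Y) - blochWignerDilog (σ Y') :=
    hg y Y Y' rfl rfl
  have e3 : g (FreeAbelianGroup.of (y / x)) =
      blochWignerDilog (σ (Y / X)) - blochWignerDilog (σ (Y' / X')) :=
    hg _ (Y / X) (Y' / X') rfl (by rw [map_div₀]; rfl)
  have e4 : g (FreeAbelianGroup.of ((1 - x⁻¹) / (1 - y⁻¹))) =
      blochWignerDilog (σ ((1 - X⁻¹) / (1 - Y⁻¹))) -
        blochWignerDilog (σ ((1 - X'⁻¹) / (1 - Y'⁻¹))) :=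
    hg _ _ _ (by push_cast; rfl)
      (by rw [map_div₀, map_sub, map_sub, map_one, map_inv₀, map_inv₀]; push_cast; rfl)
  have e5 : g (FreeAbelianGroup.of ((1 - x) / (1 - y))) =
      blochWignerDilog (σ ((1 - X) / (1 - Y))) - blochWignerDilog (σ ((1 - X') / (1 - Y'))) :=
    hg _ _ _ (by push_cast; rfl) (by rw [map_div₀, map_sub, map_sub, map_one]; push_cast; rfl)
  have h1 := five_term_algHom σ hX0 hX1 hY0 hY1 hXY
  have h2 := five_term_algHom σ hX0' hX1' hY0' hY1' hXY'
  rw [map_add, map_sub, map_add, map_sub, e1, e2, e3, e4, e5]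
  linear_combination h1 - h2

/-- **Soundness of the Galois-twisted regulator.** For every `ℚ`-embedding `σ : ℚ̄ → ℂ`, an
additive map `g : ℤ[ℂ] → ℝ` with `g[z] = D(σz) − D(σz̄)` for algebraic `z` and `g[z] = 0` for real
transcendental `z` vanishes on the relator group `⟨dilogRelators⟩ ⊆ ℤ[ℂ]`: five-term relators by
the transported five-term identity (twice), `[w] + [w̄]` because the two values
`(D(σw) − D(σw̄)) + (D(σw̄) − D(σw))` cancel, real algebraic `[w]` because `w̄ = w`. Consequently
the crux implies the stub `stub_galoisPropagation`, which is therefore safe.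
[cite: Neumann1998, §2 eq. (2.3)] -/
theorem galoisRegulator_eq_zero_of_mem_closure (g : FreeAbelianGroup ℂ →+ ℝ)
    (hg : ∀ (z : ℂ) (w w' : ↥(algebraicClosure ℚ ℂ)), (w : ℂ) = z → (w' : ℂ) = conj z →
      g (FreeAbelianGroup.of z) = blochWignerDilog (σ w) - blochWignerDilog (σ w'))
    (hg' : ∀ z : ℂ, z.im = 0 → ¬IsAlgebraic ℚ z → g (FreeAbelianGroup.of z) = 0)
    {c : FreeAbelianGroup ℂ} (hc : c ∈ AddSubgroup.closure dilogRelators) : g c = 0 := by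
  refine (AddSubgroup.closure_le (K := g.ker)).2 ?_ hc
  rintro r ((⟨x, y, hx, hy, hx0, hx1, hy0, hy1, hxy, rfl⟩ | ⟨w, hw, rfl⟩) | ⟨w, hw, rfl⟩)
  · exact galoisRegulator_fiveTerm g hg hx hy hx0 hx1 hy0 hy1 hxy
  · simp only [SetLike.mem_coe, AddMonoidHom.mem_ker, map_add]
    set W : ↥(algebraicClosure ℚ ℂ) := ⟨w, mem_algebraicClosure_iff.2 hw⟩
    set W' : ↥(algebraicClosure ℚ ℂ) := ⟨conj w, mem_algebraicClosure_iff.2 (isAlgebraic_conj hw)⟩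
    rw [hg w W W' rfl rfl, hg (conj w) W' W rfl (by simp [W]), sub_add_sub_cancel, sub_self]
  · simp only [SetLike.mem_coe, AddMonoidHom.mem_ker]
    by_cases ha : IsAlgebraic ℚ w
    · set W : ↥(algebraicClosure ℚ ℂ) := ⟨w, mem_algebraicClosure_iff.2 ha⟩
      rw [hg w W W rfl (by simpa [W] using (Complex.conj_eq_iff_im.2 hw).symm), sub_self]
    · exact hg' w hw ha

/-! ## §3 The crux implies the stub -/

/-- **Zagier's conjecture implies Galois propagation (crux ⇒ `stub_galoisPropagation`).** If a
`ℤ`-combination of Bloch–Wigner values at unimodular algebraic points of `ℍ⁺` vanishes, Zagier's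
conjecture puts `Σ mᵢ[uᵢ]` in `⟨dilogRelators⟩` (Clausen form), which the Galois-twisted regulator
`g` at `σ` kills; and `g(Σ mᵢ[uᵢ]) = Σ mᵢ (D(σuᵢ) − D(σūᵢ))`.
[cite: Neumann1998, §2.1 end (pp. 393–394): Zagier's conjecture] -/
theorem galoisPropagation_of_relationsConjecture (h : ZagierDilogarithmRelationsConjecture) :
    ∀ (k : ℕ) (u : Fin k → ℂ) (m : Fin k → ℤ), (∀ i, IsAlgebraic ℚ (u i)) →
      (∀ i, 0 < (u i).im) → (∀ i, ‖u i‖ = 1) →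
      ∑ i, (m i : ℝ) * blochWignerDilog (u i) = 0 →
        ∀ (σ : ↥(algebraicClosure ℚ ℂ) →ₐ[ℚ] ℂ) (w w' : Fin k → ↥(algebraicClosure ℚ ℂ)),
          (∀ i, (w i : ℂ) = u i) → (∀ i, (w' i : ℂ) = conj (u i)) →
          ∑ i, (m i : ℝ) * (blochWignerDilog (σ (w i)) - blochWignerDilog (σ (w' i))) = 0 := by
  intro k u m hu him hn hsum σ w w' hw hw'
  obtain ⟨g, hg, hg'⟩ := exists_galoisRegulator σ
  rw [← galoisRegulator_sum_zsmul_of g hg u m w w' hw hw']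
  exact galoisRegulator_eq_zero_of_mem_closure g hg (fun z _ hz => hg' z hz)
    (clausenForm_of_relationsConjecture h k u m hu him hn hsum)

/-- **Registered sub-goal `stub_galoisPropagationOfCrux`: the crux implies the stub
`stub_galoisPropagation`.** The same from the route decl `ZagierDilogarithmConjecture` (the crux by
name), via the Clausen transfer `zagierDilogarithmConjecture_iff_clausenForm`; so the open core (b)
of the line is implied by the crux and cannot be mis-stated against it.
[cite: Neumann1998, §2.1 end (pp. 393–394): Zagier's conjecture] -/
theorem stub_galoisPropagationOfCrux :
    Summit.KontsevichZagierPeriods.KontsevichZagierPeriods.Theses.HyperbolicBloch.ZagierDilogarithmConjecture →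
      ∀ (k : ℕ) (u : Fin k → ℂ) (m : Fin k → ℤ), (∀ i, IsAlgebraic ℚ (u i)) →
        (∀ i, 0 < (u i).im) → (∀ i, ‖u i‖ = 1) →
        ∑ i, (m i : ℝ) * blochWignerDilog (u i) = 0 →
          ∀ (σ : ↥(algebraicClosure ℚ ℂ) →ₐ[ℚ] ℂ) (w w' : Fin k → ↥(algebraicClosure ℚ ℂ)),
            (∀ i, (w i : ℂ) = u i) → (∀ i, (w' i : ℂ) = conj (u i)) →
            ∑ i, (m i : ℝ) * (blochWignerDilog (σ (w i)) - blochWignerDilog (σ (w' i))) = 0 := by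
  intro h k u m hu him hn hsum σ w w' hw hw'
  obtain ⟨g, hg, hg'⟩ := exists_galoisRegulator σ
  rw [← galoisRegulator_sum_zsmul_of g hg u m w w' hw hw']
  exact galoisRegulator_eq_zero_of_mem_closure g hg (fun z _ hz => hg' z hz)
    (zagierDilogarithmConjecture_iff_clausenForm.1 h k u m hu him hn hsum)

/-! ## §4 The imaginary quadratic case (unconditional) -/

/-- **Registered sub-goal `stub_galoisPropagationImaginaryQuadratic`: Galois propagation for points
of one imaginary quadratic field (an unconditional case of `stub_galoisPropagation`).** If
`u₁, …, u_k ∈ ℚ(√−d)` (`d > 0` rational) lie in the upper half plane and `Σ mᵢ D(uᵢ) = 0`, then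
`Σ mᵢ (D(σwᵢ) − D(σw'ᵢ)) = 0` for every `ℚ`-embedding `σ : ℚ̄ → ℂ` and lifts `wᵢ, w'ᵢ ∈ ℚ̄` of
`uᵢ, ūᵢ`: `σ(√−d) = ±√−d` with one sign, so either `σwᵢ = uᵢ, σw'ᵢ = ūᵢ` for all `i` or
`σwᵢ = ūᵢ, σw'ᵢ = uᵢ` for all `i`, and the sum is `±2 Σ mᵢ D(uᵢ) = 0` by `D(z̄) = −D(z)`.
[cite: Neumann1998, §2, Thm. 2.4 and p. 7] -/
theorem stub_galoisPropagationImaginaryQuadratic :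
    ∀ (d : ℚ), 0 < d → ∀ (k : ℕ) (u : Fin k → ℂ) (m : Fin k → ℤ),
      (∀ i, ∃ a b : ℚ, u i = a + b * (Real.sqrt d : ℂ) * Complex.I) → (∀ i, 0 < (u i).im) →
      ∑ i, (m i : ℝ) * blochWignerDilog (u i) = 0 →
        ∀ (σ : ↥(algebraicClosure ℚ ℂ) →ₐ[ℚ] ℂ) (w w' : Fin k → ↥(algebraicClosure ℚ ℂ)),
          (∀ i, (w i : ℂ) = u i) → (∀ i, (w' i : ℂ) = conj (u i)) →
          ∑ i, (m i : ℝ) * (blochWignerDilog (σ (w i)) - blochWignerDilog (σ (w' i))) = 0 := by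
  intro d hd k u m hK him hsum σ w w' hw hw'
  choose a b hab using hK
  -- `s = √d·i`: `s² = −d`, `s̄ = −s`, `s` is algebraic
  set s : ℂ := (Real.sqrt d : ℂ) * Complex.I with hs
  have hs2 : s ^ 2 = -(d : ℂ) := by
    rw [hs, mul_pow, Complex.I_sq, ← Complex.ofReal_pow, Real.sq_sqrt (by exact_mod_cast hd.le)]
    push_cast
    ring
  have hsc : conj s = -s := by
    rw [hs, map_mul, Complex.conj_ofReal, Complex.conj_I, mul_neg]
  have hsa : IsAlgebraic ℚ s := by
    refine ⟨Polynomial.X ^ 2 + Polynomial.C d, Polynomial.X_pow_add_C_ne_zero (by norm_num) d, ?_⟩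
    simp [hs2]
  have hu : ∀ i, u i = a i + b i * s := fun i => by rw [hab i, mul_assoc]
  have hu' : ∀ i, conj (u i) = a i - b i * s := fun i => by
    rw [hu i, map_add, map_mul, hsc, map_ratCast, map_ratCast]
    ring
  -- a lift `S ∈ ℚ̄` of `s`; `σ S = ± s`
  obtain ⟨S, hS⟩ : ∃ S : ↥(algebraicClosure ℚ ℂ), (S : ℂ) = s :=
    ⟨⟨s, mem_algebraicClosure_iff.2 hsa⟩, rfl⟩
  have hσS2 : σ S ^ 2 = -(d : ℂ) := by
    have e : S ^ 2 = ((-d : ℚ) : ↥(algebraicClosure ℚ ℂ)) := Subtype.ext (by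
      push_cast
      rw [hS, hs2])
    rw [← map_pow, e, map_ratCast, Rat.cast_neg]
  have hσS : σ S = s ∨ σ S = -s := by
    have e : (σ S - s) * (σ S + s) = 0 := by
      have : (σ S - s) * (σ S + s) = σ S ^ 2 - s ^ 2 := by ring
      rw [this, hσS2, hs2, sub_self]
    rcases mul_eq_zero.1 e with h | h
    · exact Or.inl (sub_eq_zero.1 h)
    · exact Or.inr (eq_neg_of_add_eq_zero_left h)
  -- the lifts in coordinates: `wᵢ = aᵢ + bᵢ S`, `w'ᵢ = aᵢ − bᵢ S`
  have hσw : ∀ i, σ (w i) = a i + b i * σ S := fun i => by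
    have e : w i = (a i : ↥(algebraicClosure ℚ ℂ)) + (b i : ↥(algebraicClosure ℚ ℂ)) * S :=
      Subtype.ext (by
        push_cast
        rw [hw i, hu i, hS])
    rw [e, map_add, map_mul, map_ratCast, map_ratCast]
  have hσw' : ∀ i, σ (w' i) = a i - b i * σ S := fun i => by
    have e : w' i = (a i : ↥(algebraicClosure ℚ ℂ)) - (b i : ↥(algebraicClosure ℚ ℂ)) * S :=
      Subtype.ext (by
        push_cast
        rw [hw' i, hu' i, hS])
    rw [e, map_sub, map_mul, map_ratCast, map_ratCast]
  -- one sign for all `i`: the summands are `ε D(uᵢ)` with `ε = ±2`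
  obtain ⟨ε, hε⟩ : ∃ ε : ℝ, ∀ i, blochWignerDilog (σ (w i)) - blochWignerDilog (σ (w' i)) =
      ε * blochWignerDilog (u i) := by
    rcases hσS with h | h
    · refine ⟨2, fun i => ?_⟩
      rw [hσw i, hσw' i, h, ← hu i, ← hu' i, blochWignerDilog_conj (him i).ne']
      ring
    · refine ⟨-2, fun i => ?_⟩
      have e1 : σ (w i) = conj (u i) := by rw [hσw i, h, hu' i]; ring
      have e2 : σ (w' i) = u i := by rw [hσw' i, h, hu i]; ring
      rw [e1, e2, blochWignerDilog_conj (him i).ne']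
      ring
  simp only [hε]
  calc ∑ i, (m i : ℝ) * (ε * blochWignerDilog (u i))
      = ε * ∑ i, (m i : ℝ) * blochWignerDilog (u i) := by
        rw [Finset.mul_sum]
        exact Finset.sum_congr rfl fun i _ => by ring
    _ = 0 := by rw [hsum, mul_zero]

end Summit.KontsevichZagierPeriods.HyperbolicBloch.ZagierDilogarithm

end
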